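import Summits.HodgeConjecture.CorCM.Census.QuarticTwistOrientation

/-!
# The quartic twist `(ℤ/4 × B, (2,0))`, XII: `β − 1` RANK-FOUR FACES GENERATE FOR EVERY FINITE `B` WITH `|B| ≥ 3`

COR-CM (cell `pub-hodgecm2`), count-neutral kernel combinatorics by the binder seat b09 (gen 32; lane QUARTIC-TWIST), part XII, sequel of part XI
(`QuarticTwistOrientation`).  Theorems only; no new definition, no `decide` table, no certificate, no named fact, no geometry, no `sorry`.
HONEST FRAMING: `HC_CM` is NOT proved; nothing here is a headline or a period.

THE PARITY-FREE GENERATION BOUND (`exists_faces_generate_all`).  For EVERY finite additive group `B` with `|B| ≥ 3` (any parity, abelian or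
not) the Hodge module of the quartic twist `G = ℤ/4 × B`, `c = (2,0)` is generated modulo the CM-pair classes by the `G`-translates of
`β − 1` rank-four faces, `β = |Orb B|` the number of blocks: `∃ S, hodge B ≤ pairs B ⊔ spanFaces B S ∧ S.card + 1 = β`.  (Part VIII proved this
for `|B|` odd via the unique regime; part IX showed `β − 1` is sharp for `|B|` odd.  For `|B|` even, parts XIII–XVII decide sharpness: `β − 1`
is the minimum for Hodge generators exactly when `B` has no element of order divisible by `4`, else `β − 2` faces already generate.)

CONSTRUCTION.  Choose for every block a representative `r` and (part XI, `exists_orientedSquare`) a cross square through `r` whose three other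
corners have smaller `Φ` and a common upper end `u_ω` (`= ` the upper end of `r` unless `r` is balanced); choose for every type `s` a group
element `g_s` with `g_s · r = s`; ORIENT by `ρ s := u_ω + (g_s)₁`.  Then `ρ` agrees with the upper end wherever one exists (`isUpper_tw_iff`,
`isUpper_unique`), so `ρ` is correct on atoms (`isUpper_atom`) and on the six closing corners (`isUpper_corners`), and the translated squares
form a `ρ`-covering family (`OCovers`); part X (`hodge_le_of_oriented_family`) gives generation, and the count `|S| = β − 1` is that of part
VIII (four residual blocks, `mk_atom_ne`; the equatorial square is not `Φ`-decreasing, `Phi_prof_le`).  All [folklore].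

## References
* [Pohlmann1968] H. Pohlmann, Algebraic cycles on abelian varieties of complex multiplication type, Ann. of Math. 88 (1968), Thm 1.
-/

namespace Summit.HodgeConjecture.CorCM.Census.QuarticTwist

open Finset

variable (B : Type) [AddGroup B] [Fintype B] [DecidableEq B]

omit [AddGroup B] in
/-- **Equatorial data for any size**: `|Q| = a` and `i ≠ j` outside `Q` whenever `a + 2 ≤ |B|`. [folklore] -/
theorem exists_equator' {a : ℕ} (ha : a + 2 ≤ Fintype.card B) :
    ∃ (Q : Finset B) (i j : B), Q.card = a ∧ i ∉ Q ∧ j ∉ Q ∧ j ≠ i := by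
  obtain ⟨Q, -, hQ⟩ := Finset.exists_subset_card_eq (s := (univ : Finset B)) (n := a) (by rw [card_univ]; omega)
  have hc : 1 < (univ \ Q).card := by rw [card_sdiff_of_subset (subset_univ Q), card_univ, hQ]; omega
  obtain ⟨i, hi, j, hj, hij⟩ := Finset.one_lt_card.mp hc
  rw [mem_sdiff] at hi hj
  exact ⟨Q, i, j, hQ, hi.2, hj.2, hij.symm⟩

omit [AddGroup B] in
/-- **The equatorial square is not `Φ`-decreasing**: `Φ(𝟙_Q) ≤ Φ(𝟙_{Q+i})` (`|Q| = a`, `|B| ∈ {2a+1, 2a+2}`). [folklore] -/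
theorem Phi_prof_le {a : ℕ} (ha : 1 ≤ a) (hn : Fintype.card B = 2 * a + 1 ∨ Fintype.card B = 2 * a + 2) (Q : Finset B)
    (hQ : Q.card = a) {i j : B} (hi : i ∉ Q) (hj : j ∉ Q) (hji : j ≠ i) : Phi B (prof B Q i 0) ≤ Phi B (prof B Q i 1) := by
  obtain ⟨c0, c1, -⟩ := isUpper_corners B ha hn Q hQ hi hj hji
  have e0 : L B 0 (prof B Q i 0) = Phi B (prof B Q i 0) := c0.1
  have e1 : L B 1 (prof B Q i 1) = Phi B (prof B Q i 1) := c1.1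
  rw [L_prof B Q hi, hQ] at e0 e1
  have l1 : lee ((1 : ZMod 4) - 0) = 1 ∧ lee ((0 : ZMod 4) - 0) = 0 ∧ lee ((1 : ZMod 4) - 1) = 0 ∧ lee ((0 : ZMod 4) - 1) = 1 := by
    refine ⟨?_, ?_, ?_, ?_⟩ <;> decide
  rw [l1.1, l1.2.1] at e0
  rw [l1.2.2.1, l1.2.2.2] at e1
  rcases hn with hn | hn <;> omega

/-- **EXISTENCE OF A GENERATING FAMILY OF `β − 1` FACES FOR EVERY FINITE `B` WITH `|B| ≥ 3`**: there is a finite family `S` of rank-four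
faces of the quartic twist with `hodge B ≤ pairs B ⊔ spanFaces B S` and `S.card + 1 = Fintype.card (Orb B)` (one ORIENTED `Φ`-decreasing cross
square through a representative of each non-residual block, the column face at `0`, the column face at `𝟙_Q` in a column `i ∉ Q` with
`|Q| = ⌊(|B| − 1)/2⌋`, and the equatorial square `(𝟙_Q; (0,i), (0,j))`). [folklore] -/
theorem exists_faces_generate_all (h3 : 3 ≤ Fintype.card B) :
    ∃ S : Finset (Ty B × (ZMod 2 × B) × (ZMod 2 × B)), (∀ f ∈ S, f.2.1 ≠ f.2.2) ∧ hodge B ≤ pairs B ⊔ spanFaces B S ∧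
      S.card + 1 = Fintype.card (Orb B) := by
  classical
  -- equatorial data
  obtain ⟨a, ha, hn⟩ : ∃ a : ℕ, 1 ≤ a ∧ (Fintype.card B = 2 * a + 1 ∨ Fintype.card B = 2 * a + 2) :=
    ⟨(Fintype.card B - 1) / 2, by omega, by omega⟩
  obtain ⟨Q, i, j, hQ, hi, hj, hji⟩ := exists_equator' B (a := a) (by omega)
  obtain ⟨b₀⟩ : Nonempty B := ⟨i⟩
  -- per-block data: an upper end (unless balanced) and, on non-residual blocks, an oriented square with that upper end
  have hsq : ∀ ω : Orb B, ∃ d : ZMod 4 × (ZMod 2 × B) × (ZMod 2 × B), ((∀ w, IsMin B w ω.out) ∨ IsUpper B d.1 ω.out) ∧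
      (¬ IsRes B ω.out → d.2.1.2 ≠ d.2.2.2 ∧ (Phi B (flip B d.2.1 ω.out) < Phi B ω.out ∧ IsUpper B d.1 (flip B d.2.1 ω.out)) ∧
        (Phi B (flip B d.2.2 ω.out) < Phi B ω.out ∧ IsUpper B d.1 (flip B d.2.2 ω.out)) ∧
        (Phi B (flip B d.2.2 (flip B d.2.1 ω.out)) < Phi B ω.out ∧ IsUpper B d.1 (flip B d.2.2 (flip B d.2.1 ω.out)))) := by
    intro ω
    by_cases h : IsRes B ω.out
    · by_cases hb : ∀ w, IsMin B w ω.out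
      · exact ⟨(0, ((0 : ZMod 2), b₀), ((0 : ZMod 2), b₀)), Or.inl hb, fun h' => (h' h).elim⟩
      · obtain ⟨u, hu⟩ := exists_isUpper B hb
        exact ⟨(u, ((0 : ZMod 2), b₀), ((0 : ZMod 2), b₀)), Or.inr hu, fun h' => (h' h).elim⟩
    · obtain ⟨u, p, q, hne, hor, h1, h2, h12⟩ := exists_orientedSquare B h3 h
      exact ⟨(u, p, q), hor, fun _ => ⟨hne, h1, h2, h12⟩⟩
  choose d hd1 hd2 using hsq
  -- a group element carrying the representative of its block to each type
  have hg0 : ∀ s : Ty B, ∃ g : ZMod 4 × B, tw B g (Quotient.mk (orbitRel B) s).out = s := fun s => by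
    have h : (orbitRel B).r (Quotient.mk (orbitRel B) s).out s := Quotient.exact (Quotient.out_eq _)
    exact h
  choose gsel hgsel using hg0
  -- THE ORIENTATION
  obtain ⟨ρ, hρdef⟩ : ∃ ρ : Ty B → ZMod 4, ρ = fun s => (d (Quotient.mk (orbitRel B) s)).1 + (gsel s).1 := ⟨_, rfl⟩
  -- `ρ` is the upper end wherever one exists
  have hρU : ∀ (s : Ty B) (u : ZMod 4), IsUpper B u s → ρ s = u := by
    intro s u hu
    obtain ⟨ω, hω⟩ : ∃ ω, Quotient.mk (orbitRel B) s = ω := ⟨_, rfl⟩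
    obtain ⟨g, hg'⟩ : ∃ g, gsel s = g := ⟨_, rfl⟩
    have hg : tw B g ω.out = s := by rw [← hg', ← hω]; exact hgsel s
    have hρs : ρ s = (d ω).1 + g.1 := by simp only [hρdef]; rw [hω, hg']
    have hr : IsUpper B (u - g.1) ω.out := by rw [← isUpper_tw_iff, hg]; exact hu
    have hd : IsUpper B (d ω).1 ω.out := (hd1 ω).resolve_left fun hb => hr.2 (hb _)
    rw [hρs, isUpper_unique B hr hd, sub_add_cancel]
  have hρ : ∀ (u : ZMod 4) (b : B) (k : ZMod 4), ρ (atom B u b k) = u := fun u b k => hρU _ _ (isUpper_atom B h3 u b k)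
  -- THE FAMILY
  set sqOf : Orb B → Ty B × (ZMod 2 × B) × (ZMod 2 × B) := fun ω => (ω.out, (d ω).2.1, (d ω).2.2) with hsqOf
  set NR : Finset (Orb B) := univ.filter fun ω => ¬ IsRes B ω.out with hNR
  set F1 : Ty B × (ZMod 2 × B) × (ZMod 2 × B) := (cst B 0, ((0 : ZMod 2), b₀), ((1 : ZMod 2), b₀)) with hF1
  set F2 : Ty B × (ZMod 2 × B) × (ZMod 2 × B) := (prof B Q i 0, ((0 : ZMod 2), i), ((1 : ZMod 2), i)) with hF2
  set F3 : Ty B × (ZMod 2 × B) × (ZMod 2 × B) := (prof B Q i 0, ((0 : ZMod 2), i), ((0 : ZMod 2), j)) with hF3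
  set S : Finset (Ty B × (ZMod 2 × B) × (ZMod 2 × B)) := NR.image sqOf ∪ {F1, F2, F3} with hSdef
  have h01 : (0 : ZMod 2) ≠ 1 := by decide
  have hF1S : F1 ∈ S := mem_union_right _ (by simp)
  have hF2S : F2 ∈ S := mem_union_right _ (by simp)
  have hF3S : F3 ∈ S := mem_union_right _ (by simp)
  -- (a) places are distinct
  have hS : ∀ f ∈ S, f.2.1 ≠ f.2.2 := by
    intro f hf
    rcases mem_union.mp hf with hf | hf
    · obtain ⟨ω, hω, rfl⟩ := mem_image.mp hf
      have hω' : ¬ IsRes B ω.out := (mem_filter.mp hω).2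
      intro h
      exact (hd2 ω hω').1 (congrArg Prod.snd h)
    · simp only [mem_insert, mem_singleton] at hf
      rcases hf with rfl | rfl | rfl
      · exact fun h => h01 (congrArg Prod.fst h)
      · exact fun h => h01 (congrArg Prod.fst h)
      · exact fun h => hji (congrArg Prod.snd h).symm
  -- (b) the family `ρ`-covers
  have hcov : OCovers B ρ (pairs B ⊔ spanFaces B S) := by
    intro s hs
    obtain ⟨ω, hω⟩ : ∃ ω, Quotient.mk (orbitRel B) s = ω := ⟨_, rfl⟩
    obtain ⟨g, hg'⟩ : ∃ g, gsel s = g := ⟨_, rfl⟩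
    have hg : tw B g ω.out = s := by rw [← hg', ← hω]; exact hgsel s
    have hρs : ρ s = (d ω).1 + g.1 := by simp only [hρdef]; rw [hω, hg']
    have hω' : ¬ IsRes B ω.out := fun h => hs ((isRes_iff_of_rel B ⟨g, hg⟩).mp h)
    have hωNR : ω ∈ NR := mem_filter.mpr ⟨mem_univ _, hω'⟩
    have hmem : sqOf ω ∈ S := mem_union_left _ (mem_image_of_mem _ hωNR)
    obtain ⟨hne, ⟨hp1, hu1⟩, ⟨hp2, hu2⟩, ⟨hp12, hu12⟩⟩ := hd2 ω hω'
    have hcorner : ∀ c : Ty B, IsUpper B (d ω).1 c → ρ (tw B g c) = ρ s := fun c hc => by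
      rw [hρs]; exact hρU _ _ ((isUpper_tw_iff B g _ c).mpr (by rw [add_sub_cancel_right]; exact hc))
    refine ⟨plc B g (d ω).2.1, plc B g (d ω).2.2, ?_, ?_, ⟨?_, ?_⟩, ⟨?_, ?_⟩, ⟨?_, ?_⟩⟩
    · simp only [plc]; exact fun h => hne (sub_left_injective h)
    · have h := transl_faceVec_mem_spanFaces B hmem g
      rw [hsqOf] at h
      simp only at h
      rw [transl_faceVec, hg] at h
      exact Submodule.mem_sup_right h
    · rw [← hg, ← tw_flip', Phi_tw, Phi_tw]; exact hp1
    · rw [← hg, ← tw_flip', hg]; exact hcorner _ hu1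
    · rw [← hg, ← tw_flip', Phi_tw, Phi_tw]; exact hp2
    · rw [← hg, ← tw_flip', hg]; exact hcorner _ hu2
    · rw [← hg, ← tw_flip', ← tw_flip', Phi_tw, Phi_tw]; exact hp12
    · rw [← hg, ← tw_flip', ← tw_flip', hg]; exact hcorner _ hu12
  -- (c) generation, by the oriented generation theorem of part X
  obtain ⟨c0, c1, cm1, c2, cj0, cj1⟩ := isUpper_corners B ha hn Q hQ hi hj hji
  have hgen : hodge B ≤ pairs B ⊔ spanFaces B S :=
    hodge_le_of_oriented_family B h3 hρ hS hcov hF1S hi hj hji (hρU _ _ c0) (hρU _ _ c1) (hρU _ _ cm1) (hρU _ _ c2) (hρU _ _ cj0)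
      (hρU _ _ cj1) hF2S hF3S
  refine ⟨S, hS, hgen, ?_⟩
  -- (d) the count: `|S| = |NR| + 3` and `|Orb| = |NR| + 4`
  have hinj : Set.InjOn sqOf ↑NR := by
    intro ω _ ω' _ h
    have h1' : ω.out = ω'.out := congrArg Prod.fst h
    rw [← Quotient.out_eq ω, ← Quotient.out_eq ω', h1']
  have hnot : ∀ ω ∈ NR, sqOf ω ≠ F1 ∧ sqOf ω ≠ F2 ∧ sqOf ω ≠ F3 := by
    intro ω hω
    have hω' : ¬ IsRes B ω.out := (mem_filter.mp hω).2
    obtain ⟨hne, ⟨hp1, -⟩, -, -⟩ := hd2 ω hω'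
    refine ⟨fun h => hne ?_, fun h => hne ?_, fun h => ?_⟩
    · simp only [hsqOf, hF1, Prod.mk.injEq] at h
      rw [h.2.1, h.2.2]
    · simp only [hsqOf, hF2, Prod.mk.injEq] at h
      rw [h.2.1, h.2.2]
    · -- the equatorial square is not `Φ`-decreasing
      simp only [hsqOf, hF3, Prod.mk.injEq] at h
      have hs : ω.out = prof B Q i 0 := h.1
      have hp : (d ω).2.1 = ((0 : ZMod 2), i) := h.2.1
      rw [hs, hp, (corners B Q hi hj hji).1] at hp1
      exact absurd hp1 (not_lt.mpr (Phi_prof_le B ha hn Q hQ hi hj hji))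
  have hdisj : Disjoint (NR.image sqOf) {F1, F2, F3} := by
    rw [Finset.disjoint_left]
    intro f hf hf'
    obtain ⟨ω, hω, rfl⟩ := mem_image.mp hf
    simp only [mem_insert, mem_singleton] at hf'
    obtain ⟨n1, n2, n3⟩ := hnot ω hω
    rcases hf' with h | h | h
    · exact n1 h
    · exact n2 h
    · exact n3 h
  have hQne : Q.Nonempty := by rw [← Finset.card_pos, hQ]; exact ha
  obtain ⟨q, hq⟩ := hQne
  have hcp : cst B 0 ≠ prof B Q i 0 := by
    intro h
    have h' := congrFun h q
    rw [prof_apply_of_mem B Q i 0 hq] at h'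
    exact absurd h' (by change (0 : ZMod 4) ≠ 1; decide)
  have hF12 : F1 ≠ F2 := by
    intro h
    simp only [hF1, hF2, Prod.mk.injEq] at h
    exact hcp h.1
  have hF13 : F1 ≠ F3 := by
    intro h
    simp only [hF1, hF3, Prod.mk.injEq] at h
    exact hcp h.1
  have hF23 : F2 ≠ F3 := by
    intro h
    simp only [hF2, hF3, Prod.mk.injEq] at h
    exact h01.symm h.2.2.1
  have hcard3 : ({F1, F2, F3} : Finset _).card = 3 := by
    rw [card_insert_of_notMem (by simp [hF12, hF13]), card_insert_of_notMem (by simp [hF23]), card_singleton]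
  have hScard : S.card = NR.card + 3 := by
    rw [hSdef, card_union_of_disjoint hdisj, card_image_of_injOn hinj, hcard3]
  -- the residual blocks are exactly four
  set R4 : Finset (Orb B) := {Quotient.mk (orbitRel B) (atom B 0 b₀ 0), Quotient.mk (orbitRel B) (atom B 0 b₀ 1),
    Quotient.mk (orbitRel B) (atom B 0 b₀ (-1)), Quotient.mk (orbitRel B) (atom B 0 b₀ 2)} with hR4
  have hR4card : R4.card = 4 := by
    have n1 := mk_atom_ne B h3 b₀ (k := 1) (k' := 0) (by decide) (by decide)
    have n2 := mk_atom_ne B h3 b₀ (k := -1) (k' := 0) (by decide) (by decide)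
    have n3 := mk_atom_ne B h3 b₀ (k := 2) (k' := 0) (by decide) (by decide)
    have n4 := mk_atom_ne B h3 b₀ (k := 1) (k' := -1) (by decide) (by decide)
    have n5 := mk_atom_ne B h3 b₀ (k := 1) (k' := 2) (by decide) (by decide)
    have n6 := mk_atom_ne B h3 b₀ (k := -1) (k' := 2) (by decide) (by decide)
    rw [hR4, card_insert_of_notMem, card_insert_of_notMem, card_insert_of_notMem, card_singleton]
    · simp only [mem_singleton]; exact n6
    · simp only [mem_insert, mem_singleton, not_or]; exact ⟨n4, n5⟩
    · simp only [mem_insert, mem_singleton, not_or]; exact ⟨n1.symm, n2.symm, n3.symm⟩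
  have hres : (univ.filter fun ω : Orb B => IsRes B ω.out) = R4 := by
    ext ω
    simp only [mem_filter, mem_univ, true_and, hR4, mem_insert, mem_singleton]
    constructor
    · rintro ⟨u, b, k, hk⟩
      have hω : ω = Quotient.mk (orbitRel B) (atom B 0 b₀ k) := by
        rw [← Quotient.out_eq ω, hk, mk_atom_eq B b₀]
      have key : ∀ k : ZMod 4, k = 0 ∨ k = 1 ∨ k = -1 ∨ k = 2 := by decide
      rcases key k with rfl | rfl | rfl | rfl
      · exact Or.inl hω
      · exact Or.inr (Or.inl hω)
      · exact Or.inr (Or.inr (Or.inl hω))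
      · exact Or.inr (Or.inr (Or.inr hω))
    · intro h
      have aux : ∀ k : ZMod 4, ω = Quotient.mk (orbitRel B) (atom B 0 b₀ k) → IsRes B ω.out := by
        intro k hk
        have hrel : (orbitRel B).r ω.out (atom B 0 b₀ k) := Quotient.exact (by rw [Quotient.out_eq]; exact hk)
        exact (isRes_iff_of_rel B hrel).mpr ⟨0, b₀, k, rfl⟩
      rcases h with h | h | h | h
      · exact aux 0 h
      · exact aux 1 h
      · exact aux (-1) h
      · exact aux 2 h
  have hOrb : Fintype.card (Orb B) = NR.card + 4 := by
    rw [← Finset.card_univ, ← Finset.card_filter_add_card_filter_not (fun ω : Orb B => IsRes B ω.out), hres, hR4card, hNR]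
    ring
  rw [hScard, hOrb]

end Summit.HodgeConjecture.CorCM.Census.QuarticTwist
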